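import Summits.QuantumFields.YangMills.Theorems.SwapTwistDeficitTwistRatioFloorFixedL
import Summits.QuantumFields.YangMills.Theorems.ToronValleyVolumePeriodicRingCeilingLaplace
import Summits.QuantumFields.YangMills.Theorems.SwapVirialDeficitSwapRingLogFreeFloor
import HarnessLib

/-!
# The twist ratio decays NO FASTER than `β^{−1/2}/log β` at every fixed `L` — UNCONDITIONALLY
# (free-hands support of item stmt-QuantumFields-24197 `SwapVirialDeficit.SwapGluedStiffness`; the instantiation of seat w2 g54's parametric
# ✓`TwistRatioFloor.twistRatio_floor_of_exists` with the two bricks that landed on 2026-08-31: the periodic CEILING with its logarithm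
# ✓`PeriodicRingCeiling.log_physTrace_ceiling` (seat fcl-p3 g43) and the log-free swap FLOOR ✓`SwapRing.swap_twistTrace_floor_rpow` (this seat);
# LEAD ym-line-sfw-p2 g93's 07:01Z ruling «(B-v) … instantiation of ✓p813830 → whoever lands the last input (default w3)»)

★★★ `twistRatio_floor` — for every `L ≥ 1` there are `κ_L > 0` and `β₀` with
`κ_L · β^{−1/2} / log β ≤ TT.twistTrace L β (2L) / TT.physTrace L β (2L)` for all `β ≥ β₀`:
the LOWER half of the fixed-`L` prediction row `⟨S⟩_β = Z^S/Z ≍ β^{−1/2}/log β` of seat w2 g54's stratum census SWAP-STRATA (evidence #2 on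
⟨stmt-QuantumFields-23802⟩): `Z ≤ C·e^{12βL⁴}β^{−(9L⁴−3/2)}·log β` (periodic toron valley, RLCT `9L⁴ − 3/2`, multiplicity `2`) against
`Z^S ≥ c·e^{12βL⁴}β^{−(9L⁴−1)}` (swap-central cone of commuting triples plus one slaved letter, RLCT `9L⁴ − 1`, multiplicity `1`).  So the vanishing
`⟨S⟩_β → 0` of the CLOSED item ⟨23802⟩ `TwistRatioVanishesFixedL` happens no faster than `β^{−1/2}/log β`.  The UPPER half `⟨S⟩ ≤ C_L·β^{−1/2}/log β` needs the
swap CEILING over all eight σ-sectors ((B-i…v) of the cell's plan, in progress) and is NOT proved here.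
HONEST LABEL: a fixed-`L` statement with constants of size `exp(O(L⁴ log L))`; nothing uniform in `L`; ⟨24197⟩, ⟨24194⟩, ⟨24497⟩, ⟨24196⟩ stay OPEN; no crux,
rung or summit is proved; the Yang–Mills mass gap is NOT proved; no summit is proved by a line.  THEOREMS ONLY (0 `def`, 0 `sorry`), standard axioms.
Width seat ym-line-sfw-p2-w3 g61 (cell ym-idea-1, free hands), `--supports stmt-QuantumFields-24197`.
References: [cite: tHooft1979]; [cite: Luscher1983, §2]; [cite: Vanbaal2001]; [cite: GonzalezarroyoAltes1988]; [folklore].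
-/

set_option autoImplicit false

noncomputable section

open Summit.QuantumFields.YangMills.Theorems.FemtoTransferGap
open Summit.QuantumFields.YangMills.Theorems.FemtoTransferGap.TT

namespace Summit.QuantumFields.YangMills.Theorems.SwapTwistDeficit.TwistRatioFloor

/-- ★★★ **The twist ratio decays no faster than `β^{−1/2}/log β` at every fixed `L ≥ 1`, unconditionally**: there are `κ > 0` and `β₀` with
`κ·β^{−1/2}/log β ≤ TT.twistTrace L β (2L) / TT.physTrace L β (2L)` for `β ≥ β₀` — ✓`twistRatio_floor_of_exists` fed with
✓`PeriodicRingCeiling.log_physTrace_ceiling` (periodic ceiling with its logarithm) and ✓`SwapRing.swap_twistTrace_floor_rpow` (log-free swap floor).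
[cite: tHooft1979] [cite: Luscher1983, §2] [cite: Vanbaal2001] -/
theorem twistRatio_floor (L : ℕ) [NeZero L] :
    ∃ κ : ℝ, 0 < κ ∧ ∃ β₀ : ℝ, ∀ β : ℝ, β₀ ≤ β →
      κ * (β ^ (-(1 / 2 : ℝ)) / Real.log β) ≤ TT.twistTrace L β (2 * L) / TT.physTrace L β (2 * L) :=
  twistRatio_floor_of_exists (L := L) NeZero.one_le (ToronValleyVolume.PeriodicRingCeiling.log_physTrace_ceiling L)
    (SwapVirialDeficit.SwapRing.swap_twistTrace_floor_rpow L)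

end Summit.QuantumFields.YangMills.Theorems.SwapTwistDeficit.TwistRatioFloor

end
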